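import Literature.NumberTheory.LFunctions.ZetaScrewThm42Proofs
import Mathlib.Analysis.Real.Pi.Bounds
import HarnessLib

/-!
# Route IntegerScrew — local coercivity of Suzuki's screw function (the margin in Thm 4.2)

Helper file for crux `IntegerScrew.ScrewPolyFloor` (stmt-RiemannHypothesis-15757), idea card
`Cruxes/ScrewPolyFloor/Ideas/rh-free-window-floor.md` (crux-strategist gen 1): the RH-free
polynomial floor on balanced short windows (`IntegerScrewScrewPolyFloorWindowFloor.lean`) rests
on the following quantitative form of Suzuki2023 Thm 4.2 (the local screw property of `-Ψ`,
proved in the tree in `ZetaScrewThm42Proofs.lean`), whose MARGIN the tree's proof throws away: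

* `sum_sum_mul_zetaScrew_le_neg_energy` — with `E = ∫_{-a}^{a} H²` the energy of the partial-sum
  step function `H(u) = ∑ wᵢ 1[u ≤ sᵢ]` (`∑ wᵢ = 0`, `|sᵢ| < a`),
  `∑ᵢⱼ wᵢwⱼ Ψ(sᵢ - sⱼ) ≤ -(1 - log 2)·E` whenever `∑_{k<K} 2/λ_k ≥ A + 2` and
  `a ≤ min((log 2)/2, 1/(4(K+1)))` (`λ_k = 2k + 1/2`, `A = γ₀ + π/2 + 3 log 2 + log π`): pole part
  `≤ (log 2)E` (`cosh_term_le`), linear part `= +A·E` (`sum_sum_mul_abs_sub_eq`), archimedean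
  part `≤ -(∑_{k<K} 2/λ_k - 4aK)E` (`sum_sum_mul_exp_ge`) — the public lemmas of
  `Suzuki2023Thm42`, reassembled with the margin kept;
* `const_add_two_le_sum_range_34` — `K = 34` works (`γ₀ < 2/3`, `π < 3.15`, `log π < 2 log 2`,
  `log 2 < 0.6931471808`; `∑_{k<34} 4/(4k+1) > 7.746`), whence `a = 1/140`;
* `energy_lower_bound` — for `δ`-separated points with `|sᵢ| + δ/2 ≤ a`, `E ≥ (δ/4)·∑ wᵢ²`: on
  `(sᵢ - δ/2, sᵢ]` and `(sᵢ, sᵢ + δ/2]` the step function takes the two values `T`, `T - wᵢ`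
  (`stepSum_eq_left/right`), the `2m` half-windows are pairwise disjoint
  (`sum_plateaus_le_sq`), and `T² + (T - wᵢ)² ≥ wᵢ²/2`;
* `local_coercivity` — combined: for `δ`-separated `sᵢ` with `|sᵢ| + δ/2 ≤ 1/140` and
  `∑ wᵢ = 0`, `(1 - log 2)·(δ/4)·∑ wᵢ² ≤ -∑ᵢⱼ wᵢwⱼ Ψ(sᵢ - sⱼ)`.

Everything is elementary (finite sums, interval integrals of step functions); no zero of `ζ`
and no prime enters (the configurations live on the wall `|v| < log 2`).

## References

* M. Suzuki, *Aspects of the screw function corresponding to the Riemann zeta-function*,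
  J. Lond. Math. Soc. (2) 108 (2023), 1448–1487; arXiv:2206.03682, Thm 4.2 and §4.3. [Suzuki2023]
-/

noncomputable section

open scoped Topology BigOperators
open MeasureTheory Set

-- the layout-mandated namespace repeats the summit name
set_option linter.dupNamespace false

namespace Summit.RiemannHypothesis.RiemannHypothesis.Theorems.IntegerScrewLocalFloor

open Literature.NumberTheory.LFunctions
open Literature.NumberTheory.LFunctions.Suzuki2023Thm42

/-- **The margin in Suzuki2023 Thm 4.2.** Under the hypotheses of
`Suzuki2023Thm42.sum_sum_mul_zetaScrew_nonpos` (`∑_{k<K} 2/λ_k ≥ A + 2`,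
`0 < a ≤ min((log 2)/2, 1/(4(K+1)))`, points `|sᵢ| < a`, weights of total mass `0`) the proof in
the tree actually gives `∑ᵢⱼ wᵢ wⱼ Ψ(sᵢ - sⱼ) ≤ -(1 - log 2)·E` with
`E = ∫_{-a}^{a} (∑ᵢ wᵢ 1[u ≤ sᵢ])² ≥ 0` the energy of the partial-sum step function
(`(log 2)E + A E - (∑_{k<K} 2/λ_k - 4aK)E ≤ (log 2 - 1)E`); we keep that margin. [folklore] -/
theorem sum_sum_mul_zetaScrew_le_neg_energy {K : ℕ}
    (hK : Real.eulerMascheroniConstant + Real.pi / 2 + 3 * Real.log 2 + Real.log Real.pi + 2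
      ≤ ∑ k ∈ Finset.range K, 2 / (2 * (k : ℝ) + 1 / 2))
    {a : ℝ} (ha : 0 < a) (ha₁ : a ≤ Real.log 2 / 2) (ha₂ : a ≤ 1 / (4 * ((K : ℝ) + 1)))
    {m : ℕ} (s w : Fin m → ℝ) (hs : ∀ i, |s i| < a) (hw : ∑ i, w i = 0) :
    ∑ i, ∑ j, w i * w j * zetaScrew (s i - s j)
      ≤ -(1 - Real.log 2) * ∫ u in (-a)..a, (∑ i, (if u ≤ s i then w i else 0)) ^ 2 := by
  set E : ℝ := ∫ u in (-a)..a, (∑ i, (if u ≤ s i then w i else 0)) ^ 2 with hEdef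
  have hs' : ∀ i, |s i| ≤ a := fun i => (hs i).le
  have haa : -a ≤ a := by linarith
  have hE0 : 0 ≤ E := intervalIntegral.integral_nonneg haa fun u _ => sq_nonneg _
  have hEabs := sum_sum_mul_abs_sub_eq s w hs' hw
  -- the exponential sums `q k = ∑ᵢⱼ wᵢwⱼ e^{-λ_k|sᵢ - sⱼ|}` and their lower bounds
  set q : ℕ → ℝ := fun k => ∑ i, ∑ j, w i * w j * Real.exp (-((2 * k + 1 / 2) * |s i - s j|))
    with hq
  have hqE : ∀ k : ℕ, 2 * (2 * k + 1 / 2) * Real.exp (-((2 * k + 1 / 2) * (2 * a))) * E ≤ q k :=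
    fun k => sum_sum_mul_exp_ge ha _ s w hs hw hEabs
  have hq0 : ∀ k, 0 ≤ q k := fun k => (by positivity : (0 : ℝ) ≤ 2 * (2 * k + 1 / 2)
    * Real.exp (-((2 * k + 1 / 2) * (2 * a))) * E).trans (hqE k)
  have hqsum : Summable fun k : ℕ => q k / (2 * (k : ℝ) + 1 / 2) ^ 2 := by
    refine (summable_one_div_lam_sq.mul_left (∑ i, ∑ j, |w i| * |w j|)).of_norm_bounded
      (fun k => ?_)
    rw [Real.norm_eq_abs, abs_div, abs_of_pos (a := (2 * (k : ℝ) + 1 / 2) ^ 2) (by positivity),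
      mul_one_div]
    refine div_le_div_of_nonneg_right ?_ (by positivity)
    refine (Finset.abs_sum_le_sum_abs _ _).trans (Finset.sum_le_sum fun i _ =>
      (Finset.abs_sum_le_sum_abs _ _).trans (Finset.sum_le_sum fun j _ => ?_))
    rw [abs_mul, abs_mul]
    refine mul_le_of_le_one_right (by positivity) ?_
    rw [Real.abs_exp, Real.exp_le_one_iff, neg_nonpos]
    positivity
  -- partial sums of the (non-negative) series, and `e^{-x} ≥ 1 - x`
  have htsum : (∑ k ∈ Finset.range K, 2 / (2 * (k : ℝ) + 1 / 2) - 4 * a * K) * E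
      ≤ ∑' k : ℕ, q k / (2 * (k : ℝ) + 1 / 2) ^ 2 := by
    refine le_trans ?_ (hqsum.sum_le_tsum (Finset.range K) fun k _ => div_nonneg (hq0 k)
      (by positivity))
    rw [sub_mul, Finset.sum_mul]
    have hKsum : 4 * a * K * E = ∑ k ∈ Finset.range K, 4 * a * E := by
      rw [Finset.sum_const, Finset.card_range, nsmul_eq_mul]; ring
    rw [hKsum, ← Finset.sum_sub_distrib]
    refine Finset.sum_le_sum fun k _ => ?_
    have h1 : 2 / (2 * (k : ℝ) + 1 / 2) * E - 4 * a * E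
        = 2 * (2 * k + 1 / 2) * (1 + -((2 * k + 1 / 2) * (2 * a))) * E
          / (2 * (k : ℝ) + 1 / 2) ^ 2 := by
      field_simp
      ring
    rw [h1]
    refine div_le_div_of_nonneg_right ?_ (by positivity)
    refine le_trans ?_ (hqE k)
    have h2 := Real.add_one_le_exp (-((2 * k + 1 / 2) * (2 * a)))
    have h3 : 0 ≤ 2 * (2 * (k : ℝ) + 1 / 2) * E := by positivity
    nlinarith [h2, h3]
  -- the pole term
  have hcoshle : 8 * (∑ i, w i * (Real.cosh (s i / 2) - 1)) ^ 2 ≤ Real.log 2 * E := by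
    refine (cosh_term_le ha.le s w hs' hw).trans (mul_le_mul_of_nonneg_right ?_ hE0)
    have h1 : Real.exp a ≤ 2 := by
      calc Real.exp a ≤ Real.exp (Real.log 2) :=
            Real.exp_le_exp.2 (by linarith [Real.log_pos one_lt_two])
        _ = 2 := Real.exp_log two_pos
    nlinarith [Real.exp_pos a, h1]
  -- assemble
  rw [sum_sum_mul_zetaScrew_eq ha₁ s w hs hw, hEabs]
  have h4aK : 4 * a * K ≤ 1 := by
    have hK1 : (0 : ℝ) < 4 * ((K : ℝ) + 1) := by positivity
    have := (le_div_iff₀ hK1).1 ha₂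
    nlinarith
  have hsinh : 0 ≤ 8 * (∑ i, w i * Real.sinh (s i / 2)) ^ 2 := by positivity
  have hmain : (∑ k ∈ Finset.range K, 2 / (2 * (k : ℝ) + 1 / 2) - 4 * a * K) * E
      ≥ (Real.eulerMascheroniConstant + Real.pi / 2 + 3 * Real.log 2 + Real.log Real.pi + 1)
          * E := by
    exact mul_le_mul_of_nonneg_right (by linarith) hE0
  nlinarith [htsum, hcoshle, hsinh, hE0, hmain]

/-- The numerical input: with `K = 34`, `∑_{k<34} 2/λ_k = ∑_{k<34} 4/(4k+1) > 7.746 ≥ A + 2`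
where `A = γ₀ + π/2 + 3 log 2 + log π < 2/3 + 1.575 + 5 log 2 < 5.708` (`γ₀ < 2/3`, `π < 3.15`,
`log π < log 4 = 2 log 2`, `log 2 < 0.6931471808`). [folklore] -/
theorem const_add_two_le_sum_range_34 :
    Real.eulerMascheroniConstant + Real.pi / 2 + 3 * Real.log 2 + Real.log Real.pi + 2
      ≤ ∑ k ∈ Finset.range 34, 2 / (2 * (k : ℝ) + 1 / 2) := by
  have hγ := Real.eulerMascheroniConstant_lt_two_thirds
  have hπ := Real.pi_lt_d2
  have hlog2 := Real.log_two_lt_d9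
  have hlogπ : Real.log Real.pi ≤ 2 * Real.log 2 := by
    have h4 : Real.log Real.pi ≤ Real.log 4 :=
      Real.log_le_log Real.pi_pos (by linarith [Real.pi_lt_four])
    have h4' : Real.log 4 = 2 * Real.log 2 := by
      rw [show (4 : ℝ) = 2 ^ 2 by norm_num, Real.log_pow]; norm_num
    linarith
  have hsum : (7746 : ℝ) / 1000 ≤ ∑ k ∈ Finset.range 34, 2 / (2 * (k : ℝ) + 1 / 2) := by
    simp only [Finset.sum_range_succ, Finset.sum_range_zero, Nat.cast_zero, Nat.cast_succ]
    norm_num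
  linarith

/-- Left plateau: for `δ`-separated points, on `(sᵢ - δ/2, sᵢ]` the step function
`H(u) = ∑ⱼ wⱼ 1[u ≤ sⱼ]` is constant, equal to `H(sᵢ) = ∑_{sⱼ ≥ sᵢ} wⱼ`. [folklore] -/
theorem stepSum_eq_left {m : ℕ} {δ : ℝ} (s w : Fin m → ℝ)
    (hsep : ∀ i j, i ≠ j → δ ≤ |s i - s j|) (i : Fin m) {u : ℝ}
    (hu₁ : s i - δ / 2 < u) (hu₂ : u ≤ s i) :
    ∑ j, (if u ≤ s j then w j else 0) = ∑ j, (if s i ≤ s j then w j else 0) := by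
  refine Finset.sum_congr rfl fun j _ => ?_
  by_cases hij : s i ≤ s j
  · rw [if_pos (hu₂.trans hij), if_pos hij]
  · have hne : i ≠ j := fun h => hij (h ▸ le_rfl)
    have hδ' := hsep i j hne
    rw [abs_of_pos (by linarith [lt_of_not_ge hij])] at hδ'
    rw [if_neg (by linarith), if_neg hij]

/-- Right plateau: for `δ`-separated points, on `(sᵢ, sᵢ + δ)` the step function equals
`H(sᵢ) - wᵢ = ∑_{sⱼ > sᵢ} wⱼ`. [folklore] -/
theorem stepSum_eq_right {m : ℕ} {δ : ℝ} (s w : Fin m → ℝ)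
    (hsep : ∀ i j, i ≠ j → δ ≤ |s i - s j|) (i : Fin m) {u : ℝ}
    (hu₁ : s i < u) (hu₂ : u < s i + δ) :
    ∑ j, (if u ≤ s j then w j else 0) = (∑ j, (if s i ≤ s j then w j else 0)) - w i := by
  have h1 : ∑ j, (if u ≤ s j then w j else 0) = ∑ j, (if s i < s j then w j else 0) := by
    refine Finset.sum_congr rfl fun j _ => ?_
    by_cases hij : s i < s j
    · have hne : i ≠ j := fun h => by subst h; exact lt_irrefl _ hij
      have hδ' := hsep i j hne
      rw [abs_of_neg (by linarith)] at hδ'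
      rw [if_pos (by linarith), if_pos hij]
    · rw [if_neg (by linarith [le_of_not_gt hij]), if_neg hij]
  have h2 : ∑ j, (if s i ≤ s j then w j else 0) - ∑ j, (if s i < s j then w j else 0) = w i := by
    rw [← Finset.sum_sub_distrib, Finset.sum_eq_single i]
    · simp
    · intro j _ hji
      by_cases hij : s i < s j
      · rw [if_pos hij.le, if_pos hij, sub_self]
      · have hδ' := hsep i j (Ne.symm hji)
        have hne : ¬ s i ≤ s j := fun h => by
          have heq : s i = s j := le_antisymm h (le_of_not_gt hij)
          rw [heq, sub_self, abs_zero] at hδ'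
          linarith
        rw [if_neg hne, if_neg hij, sub_self]
    · intro h; exact absurd (Finset.mem_univ i) h
  rw [h1]
  linarith

/-- Pointwise: the squared step function dominates the sum of its squared plateau values on the
(pairwise disjoint) half-windows `(sᵢ - δ/2, sᵢ]`, `(sᵢ, sᵢ + δ/2]`. [folklore] -/
theorem sum_plateaus_le_sq {m : ℕ} {δ : ℝ} (hδ : 0 < δ) (s w : Fin m → ℝ)
    (hsep : ∀ i j, i ≠ j → δ ≤ |s i - s j|) (u : ℝ) :
    ∑ i, ((Set.Ioc (s i - δ / 2) (s i)).indicator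
          (fun _ => (∑ j, (if s i ≤ s j then w j else 0)) ^ 2) u
        + (Set.Ioc (s i) (s i + δ / 2)).indicator
          (fun _ => ((∑ j, (if s i ≤ s j then w j else 0)) - w i) ^ 2) u)
      ≤ (∑ j, (if u ≤ s j then w j else 0)) ^ 2 := by
  by_cases h : ∃ i, u ∈ Set.Ioc (s i - δ / 2) (s i + δ / 2)
  · obtain ⟨i, hi⟩ := h
    rw [Finset.sum_eq_single i]
    · by_cases hu : u ≤ s i
      · rw [Set.indicator_of_mem (show u ∈ Set.Ioc (s i - δ / 2) (s i) from ⟨hi.1, hu⟩),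
          Set.indicator_of_notMem (fun h => not_lt.2 hu h.1), add_zero,
          stepSum_eq_left s w hsep i hi.1 hu]
      · push Not at hu
        rw [Set.indicator_of_notMem (fun h => (not_le.2 hu) h.2),
          Set.indicator_of_mem (show u ∈ Set.Ioc (s i) (s i + δ / 2) from ⟨hu, hi.2⟩), zero_add,
          stepSum_eq_right s w hsep i hu (by linarith [hi.2])]
    · intro j _ hji
      have hδ' := hsep j i hji
      have hnot1 : u ∉ Set.Ioc (s j - δ / 2) (s j) := fun hj => by
        have : |s j - s i| < δ := by
          rw [abs_lt]; constructor <;> linarith [hj.1, hj.2, hi.1, hi.2]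
        linarith
      have hnot2 : u ∉ Set.Ioc (s j) (s j + δ / 2) := fun hj => by
        have : |s j - s i| < δ := by
          rw [abs_lt]; constructor <;> linarith [hj.1, hj.2, hi.1, hi.2]
        linarith
      rw [Set.indicator_of_notMem hnot1, Set.indicator_of_notMem hnot2, add_zero]
    · intro h; exact absurd (Finset.mem_univ i) h
  · push Not at h
    refine le_of_eq_of_le ?_ (sq_nonneg _)
    refine Finset.sum_eq_zero fun i _ => ?_
    have hi := h i
    have hnot1 : u ∉ Set.Ioc (s i - δ / 2) (s i) := fun h1 => hi ⟨h1.1, by linarith [h1.2]⟩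
    have hnot2 : u ∉ Set.Ioc (s i) (s i + δ / 2) := fun h2 => hi ⟨by linarith [h2.1], h2.2⟩
    rw [Set.indicator_of_notMem hnot1, Set.indicator_of_notMem hnot2, add_zero]

/-- `∫_{-a}^{a} c·1_{(p,q]} = c (q - p)` for `-a ≤ p ≤ q ≤ a`. [folklore] -/
theorem integral_indicator_Ioc_const {a p q : ℝ} (c : ℝ) (hp : -a ≤ p) (hpq : p ≤ q)
    (hq : q ≤ a) :
    ∫ u in (-a)..a, (Set.Ioc p q).indicator (fun _ => c) u = c * (q - p) := by
  have haa : -a ≤ a := hp.trans (hpq.trans hq)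
  have hsub : Set.Ioc p q ⊆ Set.Ioc (-a) a := fun x hx => ⟨lt_of_le_of_lt hp hx.1, hx.2.trans hq⟩
  rw [intervalIntegral.integral_of_le haa, setIntegral_indicator measurableSet_Ioc,
    Set.inter_eq_right.2 hsub, setIntegral_const, Real.volume_real_Ioc_of_le hpq, smul_eq_mul]
  ring

/-- Constant multiples of indicators of intervals are interval integrable. [folklore] -/
theorem intervalIntegrable_indicator_Ioc_const (p q c x y : ℝ) :
    IntervalIntegrable (fun u => (Set.Ioc p q).indicator (fun _ => c) u) volume x y := by
  refine intervalIntegrable_of_abs_le (measurable_const.indicator measurableSet_Ioc) (M := |c|)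
    (fun u => ?_) x y
  by_cases hu : u ∈ Set.Ioc p q
  · rw [Set.indicator_of_mem hu]
  · rw [Set.indicator_of_notMem hu, abs_zero]; exact abs_nonneg c

/-- **Energy lower bound.** If the points `sᵢ` are `δ`-separated and the windows
`[sᵢ - δ/2, sᵢ + δ/2]` lie in `[-a, a]`, then the energy of the step function
`H(u) = ∑ wᵢ 1[u ≤ sᵢ]` satisfies `∫_{-a}^{a} H² ≥ (δ/4) ∑ wᵢ²`: on `(sᵢ - δ/2, sᵢ]` and
`(sᵢ, sᵢ + δ/2]` the function takes the values `T` and `T - wᵢ`, and `T² + (T - wᵢ)² ≥ wᵢ²/2`.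
[folklore] -/
theorem energy_lower_bound {m : ℕ} {a δ : ℝ} (ha : 0 ≤ a) (hδ : 0 < δ) (s w : Fin m → ℝ)
    (hsep : ∀ i j, i ≠ j → δ ≤ |s i - s j|) (hs : ∀ i, |s i| + δ / 2 ≤ a) :
    δ / 4 * ∑ i, w i ^ 2 ≤ ∫ u in (-a)..a, (∑ i, (if u ≤ s i then w i else 0)) ^ 2 := by
  set T : Fin m → ℝ := fun i => ∑ j, (if s i ≤ s j then w j else 0) with hT
  have haa : -a ≤ a := by linarith
  have hsi : ∀ i, -a ≤ s i - δ / 2 ∧ s i + δ / 2 ≤ a := fun i => by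
    have h1 := le_abs_self (s i)
    have h2 := neg_abs_le (s i)
    have h3 := hs i
    constructor <;> linarith
  have hint1 : ∀ i, IntervalIntegrable
      (fun u => (Set.Ioc (s i - δ / 2) (s i)).indicator (fun _ => T i ^ 2) u) volume (-a) a :=
    fun i => intervalIntegrable_indicator_Ioc_const _ _ _ _ _
  have hint2 : ∀ i, IntervalIntegrable
      (fun u => (Set.Ioc (s i) (s i + δ / 2)).indicator (fun _ => (T i - w i) ^ 2) u)
        volume (-a) a :=
    fun i => intervalIntegrable_indicator_Ioc_const _ _ _ _ _
  calc δ / 4 * ∑ i, w i ^ 2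
      ≤ ∑ i, (T i ^ 2 * (s i - (s i - δ / 2)) + (T i - w i) ^ 2 * (s i + δ / 2 - s i)) := by
        rw [Finset.mul_sum]
        refine Finset.sum_le_sum fun i _ => ?_
        have := mul_nonneg hδ.le (sq_nonneg (2 * T i - w i))
        nlinarith [this]
    _ = ∑ i, ∫ u in (-a)..a,
          ((Set.Ioc (s i - δ / 2) (s i)).indicator (fun _ => T i ^ 2) u
            + (Set.Ioc (s i) (s i + δ / 2)).indicator (fun _ => (T i - w i) ^ 2) u) := by
        refine Finset.sum_congr rfl fun i _ => ?_
        rw [intervalIntegral.integral_add (hint1 i) (hint2 i),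
          integral_indicator_Ioc_const _ (hsi i).1 (by linarith) (by linarith [(hsi i).2]),
          integral_indicator_Ioc_const _ (by linarith [(hsi i).1]) (by linarith) (hsi i).2]
    _ = ∫ u in (-a)..a, ∑ i,
          ((Set.Ioc (s i - δ / 2) (s i)).indicator (fun _ => T i ^ 2) u
            + (Set.Ioc (s i) (s i + δ / 2)).indicator (fun _ => (T i - w i) ^ 2) u) :=
        (intervalIntegral.integral_finsetSum fun i _ => (hint1 i).add (hint2 i)).symm
    _ ≤ ∫ u in (-a)..a, (∑ i, (if u ≤ s i then w i else 0)) ^ 2 :=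
        intervalIntegral.integral_mono_on haa
          (intervalIntegrable_sum_fun _ fun i _ => (hint1 i).add (hint2 i))
          (intervalIntegrable_stepSum_sq s w _ _)
          (fun u _ => sum_plateaus_le_sq hδ s w hsep u)


/-! ### Local coercivity of `-Ψ` -/

/-- **Local coercivity of Suzuki's screw function** (quantitative form of Suzuki2023 Thm 4.2 on
separated configurations). For `δ`-separated points `sᵢ` with `|sᵢ| + δ/2 ≤ 1/140` and real
weights of total mass `0`:
`(1 - log 2)·(δ/4)·∑ wᵢ² ≤ -∑ᵢⱼ wᵢ wⱼ Ψ(sᵢ - sⱼ)`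
(`sum_sum_mul_zetaScrew_le_neg_energy` with `K = 34`, `a = 1/140 = 1/(4(K+1))`, and
`energy_lower_bound`). [folklore] -/
theorem local_coercivity {m : ℕ} {δ : ℝ} (hδ : 0 < δ) (s w : Fin m → ℝ)
    (hsep : ∀ i j, i ≠ j → δ ≤ |s i - s j|) (hs : ∀ i, |s i| + δ / 2 ≤ 1 / 140)
    (hw : ∑ i, w i = 0) :
    (1 - Real.log 2) * (δ / 4) * ∑ i, w i ^ 2
      ≤ -∑ i, ∑ j, w i * w j * zetaScrew (s i - s j) := by
  have ha : (0 : ℝ) < 1 / 140 := by norm_num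
  have ha₁ : (1 : ℝ) / 140 ≤ Real.log 2 / 2 := by linarith [Real.log_two_gt_d9]
  have ha₂ : (1 : ℝ) / 140 ≤ 1 / (4 * (((34 : ℕ) : ℝ) + 1)) := by norm_num
  have hs' : ∀ i, |s i| < 1 / 140 := fun i => by linarith [hs i]
  have h1 := sum_sum_mul_zetaScrew_le_neg_energy const_add_two_le_sum_range_34 ha ha₁ ha₂
    s w hs' hw
  have h2 := energy_lower_bound ha.le hδ s w hsep hs
  have hlog : Real.log 2 < 1 := by linarith [Real.log_two_lt_d9]
  have h3 := mul_le_mul_of_nonneg_left h2 (by linarith : (0 : ℝ) ≤ 1 - Real.log 2)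
  linarith

end Summit.RiemannHypothesis.RiemannHypothesis.Theorems.IntegerScrewLocalFloor

end
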